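import Summits.Ventures.PercRepro.RankLevelSetExplicitLin2KeyQuart

/-!
# PercRepro — THE LEVEL-11 QUART ROW OF C-025: THE KEY AT `p = 4 309` AND THE CONDITIONAL LEVEL STEP (p9, S4)

`proofs/SUBCLAIM-S4-p9.md` §S4.2⁗‴. The saturated row of record at level `11` is `p ≥ 18 780` (RankLevelSetExplicitLin2RowEleven).
With p4's quart multiplicity the assembled inequality `(P_d)` holds, exactly evaluated, at EVERY core corank `12 ≤ d ≤ 2059`
from `p = 4 309` — and fails at `p = 4 308` (corank `1 268`, the big class's saturation corank):
the quart key `KeyQ 11 4309 d` (RankLevelSetExplicitLin2KeyQuart) is checked by the kernel at the 2 048 coranks (`decide`, 1 chunk of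
2 048), and `c025_level_succ_of_keyQ_row` turns the row into the level step
**`c025_eleven_quart_step (hprev : ∀ M p, 4 308 ≤ p → RLS M p 10) : ∀ M p, 4 309 ≤ p → RLS M p 11`** (large-corank base 4 309 (LargeSharp),
tail `4 156`). The unconditional rows are composed in RankLevelSetExplicitLin2QuartFloor. Axioms: standard.
-/

open scoped Matroid

namespace PercRepro

namespace ThmN

namespace Explicit

/-- **THE QUART KEY ROW AT `(q, p) = (11, 4 309)`**: `KeyQ 11 4309 d` at every corank `12 ≤ d ≤ 2059`, by the kernel. -/
theorem key_eleven_quart_row : ∀ t < 2048, KeyQ 11 4309 (12 + t) := by decide +kernel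

/-- **THE QUART FLOOR IS EXACT**: the quart key FAILS at `p = 4 308`, corank `1 268` (the big class's saturation corank), by the kernel. -/
theorem key_eleven_quart_sharp : ¬ KeyQ 11 4308 1268 := by decide +kernel

end Explicit

variable {α : Type}

/-- **THE LEVEL-11 QUART STEP FROM `4 309`**: level `11` for every finite matroid and every `p ≥ 4 309` from level `10` for
every `p ≥ 4 308` — the quart key row at `4 309`, its monotonicity in `p`, and the wrapper `c025_level_succ_of_keyQ_row`
(the large-corank theorem from the base `4 309` of regime one (`c025_level_succ_of_keyQ_row'`, RankLevelSetExplicitLin2LargeSharp: `N₁(11) = 4 386` would bind), tail `4 156 ≤ 4 309`). -/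
theorem c025_eleven_quart_step (hprev : ∀ (M : Matroid α) [M.Finite] (p : ℕ), 4308 ≤ p → RLS M p 10) :
    ∀ (M : Matroid α) [M.Finite] (p : ℕ), 4309 ≤ p → RLS M p 11 :=
  c025_level_succ_of_keyQ_row' 10 (by norm_num) 4309 4309 le_rfl (by norm_num) (by decide +kernel) (by norm_num) (by norm_num)
    Explicit.key_eleven_quart_row hprev

end ThmN

end PercRepro
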